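import Mathlib
import HarnessLib
import Summits.NavierStokesRegularity.NavierStokesRegularity.Theses.UnthreadedRigidityDoor
import Summits.NavierStokesRegularity.NavierStokesRegularity.Theorems.SymmetryModuliCountAxisymEndLiouville

/-!
# `UnthreadedRigidityDoor.Assembly` (item stmt-NavierStokesRegularity-27587) and the door conditional on
  its one remaining open item, the window rigidity crux `UnthreadedRigidity` (stmt-27585)

* `unthreadedRigidityDoor_assembly_proof : Assembly` — pure logic: `Assembly` is
  `UnthreadedZoom → UnthreadedRigidity → AxisymEndLiouville → ConstantSliceExtinction →
  UnthreadedDoor.Target`, i.e. the type of the route's planner-authored deciding theorem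
  `Theses.UnthreadedRigidityDoor.closes` (kernel-checked in the route file); this item is that
  composition BY NAME (candidate attached to the item by refuter1 g12, 2026-08-28T12:02Z, landed here).
* `unthreadedRigidityDoor_target_of_unthreadedRigidity : UnthreadedRigidity → UnthreadedDoor.Target` —
  the door with its three PROVED items plugged in by name (`UnthreadedZoom_holds`, item 27411;
  `AxisymEndLiouville_of` = `unthreadedRigidityDoor_axisymEndLiouville_proof`, item 27586; `ConstantSliceExtinction_holds`,
  item 27409): after this file the door leaf `UnthreadedDoor.Target` (rung N0-LocalTubeDoorUnthreaded)
  depends, along THIS route, on EXACTLY ONE open statement, the local-in-time rigidity crux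
  `UnthreadedRigidity` (stmt-27585).

HONEST FRAMING: bookkeeping; the door's `Target` is NOT proved (it is proved CONDITIONALLY on the open
crux 27585), and nothing here bears on Navier–Stokes regularity; no summit statement is proved here.
-/

noncomputable section

set_option linter.dupNamespace false

namespace Summit.NavierStokesRegularity.NavierStokesRegularity.Theorems

open Summit.NavierStokesRegularity.NavierStokesRegularity.Theses.UnthreadedRigidityDoor

/-- **Item stmt-NavierStokesRegularity-27587** (`UnthreadedRigidityDoor.Assembly`): the four items
compose to the door's `Target` — by the route's own kernel-checked deciding theorem `closes`.
[folklore] -/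
theorem unthreadedRigidityDoor_assembly_proof :
    Summit.NavierStokesRegularity.NavierStokesRegularity.Theses.UnthreadedRigidityDoor.Assembly := by
  unfold Summit.NavierStokesRegularity.NavierStokesRegularity.Theses.UnthreadedRigidityDoor.Assembly
  exact fun hZ hR hL hE => closes hZ hR hL hE

/-- **The unthreaded door modulo the window rigidity crux**: with items 27411 (`UnthreadedZoom`), 27586
(`AxisymEndLiouville`) and 27409 (`ConstantSliceExtinction`) proved in the tree, `UnthreadedRigidity`
(stmt-27585, OPEN) alone implies the door's `Target`. [folklore] -/
theorem unthreadedRigidityDoor_target_of_unthreadedRigidity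
    (hR : Summit.NavierStokesRegularity.NavierStokesRegularity.Theses.UnthreadedRigidityDoor.UnthreadedRigidity) :
    Summit.NavierStokesRegularity.NavierStokesRegularity.Theses.UnthreadedDoor.Target :=
  closes UnthreadedZoom_holds hR AxisymEndLiouville_of
    ConstantSliceExtinction_holds

end Summit.NavierStokesRegularity.NavierStokesRegularity.Theorems

end
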